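import Literature.Barriers.CriticalPhenomena.GaussianDominationRouteExpansion
import Literature.Barriers.CriticalPhenomena.GaussianDominationRouteContinuity
import HarnessLib

/-!
# The printed remainder bound (6.3.2) is unsatisfiable at `M = 0` (erratum record; the v1
# vendoring "Prop. 6.1 + (6.3.2) + Lemma 8.4" of `GaussianDominationRouteExpansion.lean`)

Sibling file of `GaussianDominationRouteExpansion.lean` (barrier catalogue
`Literature/Barriers/CriticalPhenomena/`). Version 1 of that file vendored Heydenreich–van der
Hofstad's Prop. 6.1, the remainder bound (6.3.2) and Lemma 8.4 together, in existential form over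
an abstract family `(Π^{(N)})_N` of nonnegative functions, as a named fact
`HvdH2017_prop61_lemma84`, requiring for EVERY `M ≥ 0` the printed bound (6.3.2),
`|R_M(x)| ≤ Σ_{u,v} Π^{(M)}(u) J(u,v) τ(x - v)`.

That bound is a slip of the book at `M = 0`: by (6.2.20), `R_0(x) = -Σ_{(u,v)} J(u,v)
𝔼₀[𝟙_{0⇔u} P₁(v ↔ x through C̃₀)]` and `P(0 ⇔ u) = δ_{0,u} + Π^{(0)}(u)` ((6.2.7)–(6.2.10)), so the
`u = 0` term is missing from the printed right-hand side at `M = 0` (for `M ≥ 1` the bound is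
correct, by (6.2.27)–(6.2.28), and only `M → ∞` is ever used). Concretely, at `x = 0` the
identity (6.2.2) with `M = 0` reads `1 = 1 + (J⋆τ)(0) + (Π^{(0)}⋆J⋆τ)(0) + Π^{(0)}(0) + R_0(0)`,
whence `|R_0(0)| ≥ (J⋆τ)(0) = 2dp τ_p(e₁) > 0` for `p > 0`, while the printed bound gives
`|R_0(0)| ≤ (Π^{(0)}⋆J⋆τ)(0)`, i.e. `2dp τ_p(e₁) + Π^{(0)}(0) ≤ 0`. Since the v1 statement asks this
for an arbitrary NONNEGATIVE family, it is contradictory as soon as its hypotheses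
(`d ≥ d₀`, `0 < p < p_c`, `f(p) ≤ K`) are met — and they are met for `K = 2` in every dimension
`d ≥ 2` at some small `p > 0`, by the continuity of `f` on `[0, p_c)` (Lemma 8.9,
`HvdH2017_lemma89_holds`) and `f(0) = 1` (`bootF_zero`). Hence:

* `not_HvdH2017_prop61_lemma84` — the negation of the v1 statement, which is written out IN FULL
  in the theorem (v2 of this file): the named fact `HvdH2017_prop61_lemma84` itself has been
  retired from `GaussianDominationRouteExpansion.lean` (a refuted `def … : Prop` is not a fact to
  be discharged), this theorem being its only user, and the record of the erratum is kept here.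

The CORRECT inputs are in `GaussianDominationRouteLaceExpansion.lean` (the DEFINED coefficients
`lacePi` of Ch. 6 with the separate named facts `HvdH2017_prop61` — proved,
`HvdH2017_prop61_holds` —, `HvdH2017_piN_symm` — proved, `HvdH2017_piN_symm_holds` —,
`HvdH2017_lemma84`, and the remainder bound `HvdH2017_eq632` stated with `Π^{(M)} + δ_{M,0}δ_0`,
which is what (6.2.20)/(6.2.28) give — proved, `HvdH2017_eq632_holds`), Prop. 8.3 is proved from
them in `GaussianDominationRouteProp83.lean` (`HvdH2017_prop83_of_prop61_eq632_lemma84`), and the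
Hara–Slade infrared bound is reduced to Lemma 8.4 alone in
`GaussianDominationRouteLemma84Assembly.lean` (`HaraSlade1990_infraredBound_of_lemma84`).

## References

* M. Heydenreich, R. van der Hofstad, *Progress in High-Dimensional Percolation and Random
  Graphs* (Springer 2017): (6.2.2), (6.2.7)–(6.2.10), (6.2.20), (6.2.27)–(6.2.28), (6.3.1)–(6.3.2),
  Lemma 8.4 ((8.3.5)–(8.3.6)), Lemma 8.9, (8.2.6).
-/

noncomputable section

namespace Literature.Barriers.CriticalPhenomena

open MeasureTheory Filter Topology Literature.Probability.LatticeModels Literature.Probability.Percolation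
open scoped BigOperators

/-- In every dimension `d ≥ 2` there is `p ∈ (0, p_c)` with `f(p) ≤ 2` (continuity of `f` on
`[0, p_c)`, Lemma 8.9, and `f(0) = 1`). [cite: HeydenreichVanDerHofstad2017, Lemma 8.9 and Prop. 8.8 (proof, "(1) f(0) ≤ 3")] -/
theorem exists_pos_lt_criticalProb_bootF_le_two {d : ℕ} (hd : 2 ≤ d) :
    ∃ p : unitInterval, 0 < (p : ℝ) ∧ (p : ℝ) < criticalProb (zdGraph d) (0 : Site d) ∧ bootF d p ≤ 2 := by
  have hpc : 0 < criticalProb (zdGraph d) (0 : Site d) := criticalProb_zd_pos d (by omega)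
  have hpc1 : criticalProb (zdGraph d) (0 : Site d) ≤ 1 := (criticalProb_mem_Icc _ _).2
  have h0mem : (0 : unitInterval) ∈ Set.Ico (0 : unitInterval) (criticalProbI d) :=
    ⟨le_rfl, show (0 : unitInterval) < criticalProbI d by exact_mod_cast hpc⟩
  have hcont : ContinuousWithinAt (bootF d) (Set.Ico (0 : unitInterval) (criticalProbI d)) 0 :=
    HvdH2017_lemma89_holds d hd 0 h0mem
  obtain ⟨δ, hδ, H⟩ := Metric.continuousWithinAt_iff.1 hcont 1 one_pos
  -- the point `q = min(δ/2, p_c/2) ∈ (0, p_c)`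
  set q : ℝ := min (δ / 2) (criticalProb (zdGraph d) (0 : Site d) / 2) with hq
  have hq0 : 0 < q := lt_min (by linarith) (by linarith)
  have hqpc : q < criticalProb (zdGraph d) (0 : Site d) := (min_le_right _ _).trans_lt (by linarith)
  have hq1 : q ≤ 1 := hqpc.le.trans hpc1
  let qI : unitInterval := ⟨q, hq0.le, hq1⟩
  refine ⟨qI, hq0, hqpc, ?_⟩
  have hmem : qI ∈ Set.Ico (0 : unitInterval) (criticalProbI d) :=
    ⟨bot_le, show qI < criticalProbI d by exact_mod_cast hqpc⟩
  have hdist : dist qI 0 < δ := by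
    rw [Subtype.dist_eq, show ((0 : unitInterval) : ℝ) = 0 from rfl, Real.dist_0_eq_abs, abs_of_pos hq0]
    exact (min_le_left _ _).trans_lt (by linarith)
  have h := H hmem hdist
  rw [bootF_zero, Real.dist_eq, abs_lt] at h
  linarith [h.2]

/-- **The v1 vendoring "Prop. 6.1 + (6.3.2) as printed + Lemma 8.4" is false** (the statement of
the retired named fact `HvdH2017_prop61_lemma84`, written out in full: for every `K` a constant
`c̄` and a threshold `d₀` beyond which, for `p < p_c` with `f(p) ≤ K`, some nonnegative symmetric
summable family `(Π^{(N)})_N` obeys (8.3.5), (8.3.6) and, for EVERY `M`, the expansion (6.2.2)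
with the remainder bounded as printed in (6.3.2), `|R_M(x)| ≤ (Π^{(M)}⋆J⋆τ)(x)`): for `K = 2`
its hypotheses are met in every dimension `d ≥ 2` at some `p ∈ (0, p_c)`, and then its clause
`M = 0` at `x = 0` demands `p Σ_j [τ_p(-e_j) + τ_p(e_j)] + Π^{(0)}(0) ≤ 0` for a nonnegative
`Π^{(0)}`, contradicting `τ_p(e_j) ≥ p > 0`. (The printed (6.3.2) omits the `u = 0` term of `R_0`
((6.2.20), `0 ⇔ 0` being sure); see the module docstring for the corrected inputs.)
[cite: HeydenreichVanDerHofstad2017, (6.2.20) and (6.3.2) (the case M = 0); Prop. 6.1 ((6.2.1)–(6.2.3)), Lemma 8.4 ((8.3.5)–(8.3.6))] -/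
theorem not_HvdH2017_prop61_lemma84 :
    ¬ ∀ K : ℝ, ∃ cb : ℝ, 0 < cb ∧ ∃ d₀ : ℕ, ∀ d : ℕ, d₀ ≤ d →
      ∀ p : unitInterval, (p : ℝ) < criticalProb (zdGraph d) (0 : Site d) → bootF d p ≤ K →
        ∃ Ps : ℕ → Site d → ℝ,
          (∀ N x, 0 ≤ Ps N x) ∧ (∀ N x, Ps N (-x) = Ps N x) ∧ (∀ N, Summable (Ps N)) ∧
          (∀ N, ∑' x, Ps N x ≤ (cb / d) ^ max N 1) ∧
          (∀ (N : ℕ) (k : Fin d → ℝ),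
            ∑' x, (1 - Real.cos (kdot k x)) * Ps N x ≤ (1 - Dhat d k) * (cb / d) ^ max (N - 1) 1) ∧
          (∀ (M : ℕ) (x : Site d),
            |tau d p 0 x -
                ((if x = 0 then 1 else 0) +
                  (p : ℝ) * ∑ j : Fin d, (tau d p 0 (x - Pi.single j 1) + tau d p 0 (x + Pi.single j 1)) +
                  ∑' u, (∑ N ∈ Finset.range (M + 1), (-1 : ℝ) ^ N * Ps N u) *
                    ((p : ℝ) * ∑ j : Fin d,
                      (tau d p 0 (x - u - Pi.single j 1) + tau d p 0 (x - u + Pi.single j 1))) +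
                  ∑ N ∈ Finset.range (M + 1), (-1 : ℝ) ^ N * Ps N x)| ≤
              ∑' u, Ps M u *
                ((p : ℝ) * ∑ j : Fin d,
                  (tau d p 0 (x - u - Pi.single j 1) + tau d p 0 (x - u + Pi.single j 1)))) := by
  intro h
  obtain ⟨cb, -, d₀, H⟩ := h 2
  set d : ℕ := max d₀ 2 with hddef
  have hd2 : 2 ≤ d := le_max_right _ _
  obtain ⟨p, hp0, hpc, hf2⟩ := exists_pos_lt_criticalProb_bootF_le_two hd2
  obtain ⟨Ps, hPs0, -, -, -, -, hR⟩ := H d (le_max_left _ _) p hpc hf2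
  have h00 := hR 0 0
  -- the `M = 0`, `x = 0` instance: `|1 - (1 + A + S + Π^{(0)}(0))| ≤ S`
  simp only [tau_self, if_true, Finset.sum_range_one, pow_zero, one_mul, zero_sub, zero_add] at h00
  set A : ℝ := (p : ℝ) * ∑ j : Fin d, (tau d p 0 (-Pi.single j 1) + tau d p 0 (Pi.single j 1)) with hA
  set S : ℝ := ∑' u : Site d, Ps 0 u *
    ((p : ℝ) * ∑ j : Fin d, (tau d p 0 (-u - Pi.single j 1) + tau d p 0 (-u + Pi.single j 1))) with hS
  have hS0 : 0 ≤ S := tsum_nonneg fun u => mul_nonneg (hPs0 0 u)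
    (mul_nonneg p.2.1 (Finset.sum_nonneg fun j _ => add_nonneg (tau_nonneg p 0 _) (tau_nonneg p 0 _)))
  have hP0 : 0 ≤ Ps 0 0 := hPs0 0 0
  -- `A > 0`: the term `j = ⟨0, _⟩` already gives `p τ_p(e₀) > 0`
  have hApos : 0 < A := by
    have hterm : ∀ j : Fin d, 0 ≤ tau d p 0 (-Pi.single j 1) + tau d p 0 (Pi.single j 1) := fun j =>
      add_nonneg (tau_nonneg p 0 _) (tau_nonneg p 0 _)
    have j0 : Fin d := ⟨0, by omega⟩
    have hpos : 0 < tau d p 0 (-Pi.single j0 1) + tau d p 0 (Pi.single j0 1) :=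
      add_pos (tau_pos zdGraph_preconnected_holds p hp0 _ _) (tau_pos zdGraph_preconnected_holds p hp0 _ _)
    have hsum : 0 < ∑ j : Fin d, (tau d p 0 (-Pi.single j 1) + tau d p 0 (Pi.single j 1)) :=
      lt_of_lt_of_le hpos (Finset.single_le_sum (fun j _ => hterm j) (Finset.mem_univ j0))
    exact mul_pos hp0 hsum
  have habs : |1 - (1 + A + S + Ps 0 0)| = A + S + Ps 0 0 := by
    rw [show (1 : ℝ) - (1 + A + S + Ps 0 0) = -(A + S + Ps 0 0) by ring, abs_neg,
      abs_of_nonneg (by linarith)]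
  rw [habs] at h00
  linarith

end Literature.Barriers.CriticalPhenomena

end
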